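import Literature.Analysis.FunctionSpaces.BesselJAnalyticProofs
import HarnessLib

/-!
# Truncation of the power series of `J_n` (every order) with a rigorous remainder

`Literature.Analysis.FunctionSpaces.BesselJ` defines `J_n(x) = Σ_k T⁽ⁿ⁾_k(x)`,
`T⁽ⁿ⁾_k(x) = besselJTerm n x k = (−1)^k (x/2)^{2k+n}/(k!(k+n)!)` (Watson §2.1 (8); DLMF 10.2.2).
`BesselJZeroSeriesRemainder.lean` truncates the series of `J₀` and `J₁` with the sharp (alternating)
remainder.  For kernel-checked numerics with Bessel functions of EVERY order `n` at small argument —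
the Jacobi–Anger coefficients `iʲ J_j(y)`, `y = β/d`, of a twisted one-coordinate transform
(`Literature.Probability.FitznerVanDerHofstad2017.SrwTwistBesselRow`) — the crude majorant remainder
suffices and holds at every real argument and every order:

* `abs_besselJTerm_add_le`: `|T⁽ⁿ⁾_{N+j}(x)| ≤ (|x/2|^{2N+n}/(N!(N+n)!)) · (|x/2|²)ʲ/j!`;
* `abs_besselJ_sub_sum_range_le`: **`|J_n(x) − Σ_{k<N} T⁽ⁿ⁾_k(x)| ≤ |x/2|^{2N+n}/(N!(N+n)!) · e^{|x/2|²}`**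
  — the size of the first omitted term times `e^{x²/4}` (DLMF 10.14.4-type majorisation of the tail by
  the exponential series);
* `besselJ_mem_Icc_sum_range`: the enclosure form.

Dimension-free analysis, no numerical certificate; written for the b2b-lace what-if /
input-certification lane (the `J_j(β/d)` inputs of a twisted-seed kernel).

## References
* G. N. Watson, *A Treatise on the Theory of Bessel Functions* (2nd ed., 1944), §2.1 (8), §2.11 (4)–(5).
* NIST DLMF 10.2.2 (series of `J_ν`), 10.14.4 (`|J_ν(z)| ≤ |z/2|^ν e^{|Im z|}/Γ(ν+1)`-type bounds).
-/

noncomputable section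

open Real Nat

namespace Literature.Analysis.FunctionSpaces

/-- Tail terms against the first omitted one:
`|T⁽ⁿ⁾_{N+j}(x)| ≤ (|x/2|^{2N+n}/(N!(N+n)!)) · (|x/2|²)ʲ/j!` (`(N+j)! ≥ N! j!`, `(N+j+n)! ≥ (N+n)!`).
[cite: Watson1944, §2.11] -/
theorem abs_besselJTerm_add_le (n : ℕ) (x : ℝ) (N j : ℕ) :
    |besselJTerm n x (N + j)|
      ≤ |x / 2| ^ (2 * N + n) / ((N ! : ℝ) * (N + n)!) * ((|x / 2| ^ 2) ^ j / j !) := by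
  have hN : (0 : ℝ) < N ! := by positivity
  have hj : (0 : ℝ) < j ! := by positivity
  have hNn : (0 : ℝ) < (N + n)! := by positivity
  have h1 : ((N ! : ℝ) * j !) ≤ ((N + j)! : ℝ) := by
    exact_mod_cast Nat.le_of_dvd (Nat.factorial_pos _) (Nat.factorial_mul_factorial_dvd_factorial_add N j)
  have h2 : ((N + n)! : ℝ) ≤ ((N + j + n)! : ℝ) := by
    exact_mod_cast Nat.factorial_le (by omega)
  rw [besselJTerm, abs_mul, abs_div, abs_pow, abs_pow, abs_neg, abs_one, one_pow,
    abs_of_pos (by positivity : (0 : ℝ) < (N + j)! * (N + j + n)!)]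
  calc 1 / (((N + j)! : ℝ) * (N + j + n)!) * |x / 2| ^ (2 * (N + j) + n)
      ≤ 1 / (((N ! : ℝ) * j !) * (N + n)!) * |x / 2| ^ (2 * (N + j) + n) := by
        gcongr
    _ = |x / 2| ^ (2 * N + n) / ((N ! : ℝ) * (N + n)!) * ((|x / 2| ^ 2) ^ j / j !) := by
        rw [show 2 * (N + j) + n = (2 * N + n) + 2 * j by ring, pow_add, pow_mul]
        field_simp

/-- **Series remainder of `J_n` at every order**: for every `n N : ℕ` and every real `x`,
`|J_n(x) − Σ_{k<N} T⁽ⁿ⁾_k(x)| ≤ |x/2|^{2N+n}/(N!(N+n)!) · e^{|x/2|²}`.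
[cite: DLMF, 10.2.2; Watson1944, §2.11] -/
theorem abs_besselJ_sub_sum_range_le (n : ℕ) (x : ℝ) (N : ℕ) :
    |besselJ n x - ∑ k ∈ Finset.range N, besselJTerm n x k|
      ≤ |x / 2| ^ (2 * N + n) / ((N ! : ℝ) * (N + n)!) * Real.exp (|x / 2| ^ 2) := by
  have hs := hasSum_besselJ_holds n x
  -- the tail as a series
  have htail : HasSum (fun j : ℕ => besselJTerm n x (j + N))
      (besselJ n x - ∑ k ∈ Finset.range N, besselJTerm n x k) := (hasSum_nat_add_iff' N).2 hs
  have habs : Summable fun j : ℕ => |besselJTerm n x (j + N)| := htail.summable.abs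
  have hexp : HasSum (fun j : ℕ => (|x / 2| ^ 2) ^ j / j !) (Real.exp (|x / 2| ^ 2)) := by
    rw [Real.exp_eq_exp_ℝ]
    exact NormedSpace.expSeries_div_hasSum_exp (|x / 2| ^ 2 : ℝ)
  have hmaj : HasSum (fun j : ℕ => |x / 2| ^ (2 * N + n) / ((N ! : ℝ) * (N + n)!)
      * ((|x / 2| ^ 2) ^ j / j !))
      (|x / 2| ^ (2 * N + n) / ((N ! : ℝ) * (N + n)!) * Real.exp (|x / 2| ^ 2)) := hexp.mul_left _
  rw [← htail.tsum_eq]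
  calc |∑' j : ℕ, besselJTerm n x (j + N)|
      ≤ ∑' j : ℕ, |besselJTerm n x (j + N)| := by
        have := norm_tsum_le_tsum_norm (f := fun j : ℕ => besselJTerm n x (j + N))
          (by simpa [Real.norm_eq_abs] using habs)
        simpa [Real.norm_eq_abs] using this
    _ ≤ ∑' j : ℕ, |x / 2| ^ (2 * N + n) / ((N ! : ℝ) * (N + n)!) * ((|x / 2| ^ 2) ^ j / j !) :=
        habs.tsum_le_tsum (fun j => by rw [add_comm]; exact abs_besselJTerm_add_le n x N j)
          hmaj.summable
    _ = |x / 2| ^ (2 * N + n) / ((N ! : ℝ) * (N + n)!) * Real.exp (|x / 2| ^ 2) := hmaj.tsum_eq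

/-- **Enclosure form**: with `S_N = Σ_{k<N} T⁽ⁿ⁾_k(x)` and `ρ = |x/2|^{2N+n}/(N!(N+n)!) · e^{|x/2|²}`,
`J_n(x) ∈ [S_N − ρ, S_N + ρ]`. [cite: DLMF, 10.2.2; Watson1944, §2.11] -/
theorem besselJ_mem_Icc_sum_range (n : ℕ) (x : ℝ) (N : ℕ) :
    besselJ n x ∈ Set.Icc
      ((∑ k ∈ Finset.range N, besselJTerm n x k)
        - |x / 2| ^ (2 * N + n) / ((N ! : ℝ) * (N + n)!) * Real.exp (|x / 2| ^ 2))
      ((∑ k ∈ Finset.range N, besselJTerm n x k)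
        + |x / 2| ^ (2 * N + n) / ((N ! : ℝ) * (N + n)!) * Real.exp (|x / 2| ^ 2)) := by
  have h := abs_besselJ_sub_sum_range_le n x N
  rw [abs_le] at h
  constructor <;> linarith [h.1, h.2]

/-- Rational form of the exponential factor for `|x| ≤ 1`: `e^{|x/2|²} ≤ e^{1/4} ≤ 9/7`, so
`|J_n(x) − Σ_{k<N} T⁽ⁿ⁾_k(x)| ≤ (9/7) · |x/2|^{2N+n}/(N!(N+n)!)`. [cite: DLMF, 10.2.2; Watson1944, §2.11] -/
theorem abs_besselJ_sub_sum_range_le_of_abs_le_one (n : ℕ) {x : ℝ} (hx : |x| ≤ 1) (N : ℕ) :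
    |besselJ n x - ∑ k ∈ Finset.range N, besselJTerm n x k|
      ≤ 9 / 7 * (|x / 2| ^ (2 * N + n) / ((N ! : ℝ) * (N + n)!)) := by
  have hs : |x / 2| ≤ 1 / 2 := by rw [abs_div, abs_two]; linarith
  have hs0 : 0 ≤ |x / 2| := abs_nonneg _
  have h14 : |x / 2| ^ 2 ≤ 1 / 4 := by nlinarith
  have hexp : Real.exp (|x / 2| ^ 2) ≤ 9 / 7 := by
    refine (Real.exp_le_exp.2 h14).trans ?_
    have hb := Real.exp_bound' (by norm_num : (0:ℝ) ≤ 1 / 4) (by norm_num : (1:ℝ) / 4 ≤ 1)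
      (by norm_num : 0 < 3)
    refine hb.trans ?_
    simp only [Finset.sum_range_succ, Finset.sum_range_zero, Nat.factorial]
    norm_num
  calc |besselJ n x - ∑ k ∈ Finset.range N, besselJTerm n x k|
      ≤ |x / 2| ^ (2 * N + n) / ((N ! : ℝ) * (N + n)!) * Real.exp (|x / 2| ^ 2) :=
        abs_besselJ_sub_sum_range_le n x N
    _ ≤ |x / 2| ^ (2 * N + n) / ((N ! : ℝ) * (N + n)!) * (9 / 7) := by gcongr
    _ = 9 / 7 * (|x / 2| ^ (2 * N + n) / ((N ! : ℝ) * (N + n)!)) := by ring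

end Literature.Analysis.FunctionSpaces

end
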